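import Summits.QuantumFields.YangMills.Theorems.LuscherReductionTwistedTraceScalingBOChartSliceTransfer
import Summits.QuantumFields.YangMills.Theorems.LuscherReductionTwistedTraceScalingBOGaugeAvgSlice
import HarnessLib

/-!
# (C1c'-μ) ★★★ THE LOCALISED AVERAGE OF THE BO FUNCTION OF RECORD IS GAUSSIAN FROM ABOVE ON THE WHOLE (C1d) CHART BALL — hAhi of the (C1) glue, modulo (P) and the toolchain
# smallness conditions
# (lane A of S-BASE, crux `TwistedTraceScaling` stmt-QuantumFields-20203, C4-CORE, the (OD) pen; assembly of (4') of `pub/ym-fleet/ym-luscher-20007-p1/COARSE-DESIGN.md` §28.5)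

`…BOCentralTube.central_transfer_two_sided_of_localisedAvg_local` reduces (C1) to the two-sided Gaussian SHAPE of `A(V) = ∫ W(g)·boFun χ₀ Ω_G(V^{g⁻¹}) dg` on the chart ball:
hAhi on the whole ball, hAlo near inner-core fibre points.  This file supplies hAhi by composing `…BOChartSliceRep.chartPoint_slice_rep` (`P(w) = c·(tubePt p*)^{P∘ξ'}`),
`…BOChartSliceTransfer.chart_rep_transfer` (`|q(chartVec w) − q(linkEmbed p*.1)| ≤ ε_tr`, fat-tube data), `…BOGaugeAvgSlice.localisedAvg_orbit_upper` (`A(V) ≤ Z(C_χe^{ε_q}e^{−q(x*)}N(V) + C_χT)`),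
`laplace_tail_le_fpWeightBar` (`T ≤ (1+x)4^{d/2}e^{−c²r²/(4s_g²)}N̄`) and an upper bound `N ≤ N_hi` on the fat tube ((P), `…FPWeightCore`, taken as a hypothesis):
* §1 bookkeeping (`one_le_exp_mul_exp_neg_stiffGaussExp`, `exp_neg_transfer`, `gaugeAvg_recordChi_nonneg`, `boFun_frozenProfile_support`);
* §2 ★★★ `localisedAvg_chart_upper` — for every chart point of the ball `Σ_a w_e a² ≤ ρ²`:
  `A(P w) ≤ Z·C_χ·(e^{ε_q+ε_tr}·N_hi + (1+x)·4^{d/2}e^{−c²r²/(4s_g²)}·N̄(s_g)·e^{(96t+b)(√|E|ρ)²})·e^{−q_{t,b}(chartVec w)}`,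
  `ε_q = (96t+b)D(2X+D)`, `D = Br + M_Tr²`, `ε_tr = (96t+b)(D'(2X+D') + 72|E|ρ³)`, `D' = 9C_LK(4+48K)ρ² + 81M_TK²ρ²`, `X = √|E|ρ + 7|E|ρ + 9BKρ + 81M_TK²ρ²`, `x = K_D((4+48K)ρ)²`.
Schedule B (`ρ = O(Lβ^{-1/2}ℓ²)`, `r = β^{-1}ℓ³`, `s_g = β^{-1}`): `ε_q, ε_tr = O(β^{-1/2}·polylog) → 0`, the tail term is `e^{−Ω(ℓ⁶)}·e^{O(L⁵ℓ⁴)}·N̄ → 0` relative to `N̄`.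
The lower half (hAlo) is the next file `…BOLocalisedAvgChartLower`.
HONEST FRAMING: assembly for a stub of a child of the CONDITIONAL route R2b1; (C1c') lower/rates, (C4), (C5), (B-ST) OPEN; C4-CORE OPEN; not infinite volume, not a gap, not Clay.
-/

set_option autoImplicit false

noncomputable section

open MeasureTheory Real
open scoped BigOperators RealInnerProductSpace
open Literature.MathematicalPhysics.QuantumFieldTheory
open Literature.MathematicalPhysics.QuantumLattice

namespace Summit.QuantumFields.YangMills.Theorems.FemtoTransferGap.TwoLattice.ConstTube

open Summit.QuantumFields.YangMills.Theorems.FemtoTransferGap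
open Summit.QuantumFields.YangMills.Theorems.FemtoTransferGap.TwoLattice
open Summit.QuantumFields.YangMills.Theorems.FemtoTransferGap.TwoLattice.Avg
open Summit.QuantumFields.YangMills.Theorems.FemtoTransferGap.TwoLattice.Stiff
open Summit.QuantumFields.YangMills.Theorems.FemtoTransferGap.TwoLattice.GnChart
open Literature.MathematicalPhysics.QuantumFieldTheory.Balaban1983to89.T4CubeChartGnomonic (gnoPoint)

variable {L : ℕ} [NeZero L]

/-! ## §1 Elementary exponential bookkeeping -/

/-- `q_{t,b}(x) ≤ (96t+b)X²` for `‖x‖ ≤ X`, hence `1 ≤ e^{(96t+b)X²}·e^{−q(x)}`. [folklore] -/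
theorem one_le_exp_mul_exp_neg_stiffGaussExp {t : ℝ} (ht : 0 ≤ t) {b : ℝ} (hb : 0 ≤ b) {x : LinkSpace L} {X : ℝ} (hx : ‖x‖ ≤ X) :
    1 ≤ Real.exp ((96 * t + b) * X ^ 2) * Real.exp (-stiffGaussExp L t b x) := by
  rw [← Real.exp_add]
  refine Real.one_le_exp ?_
  have h := stiffGaussExp_le_mul_norm_sq ht hb x
  have hXdef : ‖x‖ ^ 2 ≤ X ^ 2 := pow_le_pow_left₀ (norm_nonneg _) hx 2
  have := mul_le_mul_of_nonneg_left hXdef (by positivity : (0 : ℝ) ≤ 96 * t + b)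
  linarith

/-- From `|q(y) − q(x)| ≤ ε`: `e^{−q(x)} ≤ e^{ε}·e^{−q(y)}` and `e^{−ε}·e^{−q(y)} ≤ e^{−q(x)}`. [folklore] -/
theorem exp_neg_transfer {qx qy ε : ℝ} (h : |qy - qx| ≤ ε) :
    Real.exp (-qx) ≤ Real.exp ε * Real.exp (-qy) ∧ Real.exp (-ε) * Real.exp (-qy) ≤ Real.exp (-qx) := by
  obtain ⟨h1, h2⟩ := abs_le.1 h
  constructor
  · rw [← Real.exp_add]; exact Real.exp_le_exp.2 (by linarith)
  · rw [← Real.exp_add]; exact Real.exp_le_exp.2 (by linarith)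

/-- `0 ≤ N(V) = gaugeAvg recordChi V`. [folklore] -/
theorem gaugeAvg_recordChi_nonneg (s K M β : ℝ) (V : GaugeConfig 3 L SU2) : 0 ≤ gaugeAvg (recordChi L s K M β) V :=
  (gaugeAvg_mem_Icc (measurable_recordWeightRho L _ _ _ β) (fun U => (recordWeightRho_mem_Icc L _ _ _ β U).1) (fun U => (recordWeightRho_mem_Icc L _ _ _ β U).2) V).1

/-- The support of the BO function of record: inside the fat tube (via `supp boFun ⊆ supp recordChi`) with `‖relLinkVec‖ ≤ r_f β`. [folklore] -/
theorem boFun_frozenProfile_support {s K M β : ℝ} {qf : ℝ → LinkSpace L → ℝ} {rf : ℝ → ℝ} {χ₀ : GaugeConfig 3 1 SU2 → ℝ}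
    (hbo : ∀ U, boFun L χ₀ (frozenProfile L qf rf β) U ≠ 0 → recordChi L s K M β U ≠ 0) (U : GaugeConfig 3 L SU2)
    (hU : boFun L χ₀ (frozenProfile L qf rf β) U ≠ 0) :
    U ∈ fatTubeRho L (fun b' => K * powScale s b') (fun b' => M * (K * powScale s b')) β ∧ ‖relLinkVec L U‖ ≤ rf β := by
  refine ⟨?_, norm_le_of_frozenProfile_ne_zero qf rf β (boFun_ne_zero L hU).2.2⟩
  have h := hbo U hU
  by_contra hnot
  apply h
  show recordWeightRho L (fun b' => K * powScale s b') (fun b' => M * (K * powScale s b')) (powScale 1) β U = 0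
  unfold recordWeightRho
  rw [Set.indicator_of_notMem hnot, zero_mul]

/-! ## §2 ★★★ The upper Gaussian bound on the whole chart ball -/

/-- ★★★ **(C1c') UPPER HALF: THE LOCALISED AVERAGE OF THE BO FUNCTION OF RECORD IS GAUSSIAN FROM ABOVE ON THE WHOLE (C1d) BALL.**  Under the (N2) toolchain data
(slice point `hSP`, Taylor `hT`, coercivity `hC`, Gaussian values `hI`, `gramDet` ratio `hD`, `basedLin` bound `hB` and Lipschitz bound `hLip`), the profile of record
`Ω = frozenProfile L q_f r_f β` with `q_f β = q_{t,b}`, a class-function amplitude `0 ≤ χ₀ ≤ C_χ` with `supp boFun χ₀ Ω ⊆ supp recordChi`, the weight `coreWeight ε R₁'` (colour FP constant `Z`),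
an upper bound `N ≤ N_hi` for the Faddeev–Popov weight on the fat tube ((P), `…FPWeightCore`), and the displayed smallness of the chart radius `ρ`, Laplace core radius `r`, support radius `R₁`,
representative link radius `ρ₁`: for every chart point of the ball `Σ_a w_e a² ≤ ρ²`,
`A(P w) ≤ Z·C_χ·(e^{ε_q+ε_tr}·N_hi + (1+x)·4^{d/2}e^{−c²r²/(4s_g²)}·N̄(s_g)·e^{(96t+b)(√|E|ρ)²})·e^{−q_{t,b}(chartVec w)}` with the displayed `ε_q, ε_tr, x`. [cite: Luscher1983, §3] -/
theorem localisedAvg_chart_upper (hL : Nonempty (NzSite L)) {s K M : ℝ} {β : ℝ} (hs1 : 0 < powScale 1 β)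
    -- the toolchain
    {Ksp εsp : ℝ} (hKsp : 0 ≤ Ksp)
    (hSP : ∀ w : Edge 3 L → Fin 3 → ℝ, w ∈ balancedSet L → ∀ c : Fin 3 → Fin 3 → ℝ, ‖w‖ < εsp → ‖c‖ < εsp →
      ∃ ξ : Site 3 L → Fin 3 → ℝ, ∑ x : Site 3 L, ξ x = 0 ∧ ‖ξ‖ ≤ Ksp * ‖w‖ ∧
        gaugeCoordSq L (gaugeTransform (fun x => chartSU2 (ξ x)) (orthoTube L (fun e₁ => chartSU2 (c e₁.2)) w)) = 0)
    {εT MT : ℝ} (hMT : 0 ≤ MT) (hεT : 0 < εT)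
    (hT : ∀ (ξ : basedSubmodule L) (q : balancedSubmodule L × (Fin 3 → Fin 3 → ℝ)), ‖ξ‖ < εT → ‖q‖ < εT →
      ‖basedFn L (ξ, q) - basedFn L (0, q) - basedLin L q ξ‖ ≤ MT * ‖ξ‖ ^ 2)
    {εC : ℝ} (hC : ∀ q : balancedSubmodule L × (Fin 3 → Fin 3 → ℝ), ‖q‖ < εC →
      ∀ ξ : basedSubmodule L, ‖ξ‖ ≤ 4 * sliceConst L * ‖(gaugeModes L).starProjection (basedLin L q ξ)‖)
    {εI : ℝ} (hI : ∀ q : balancedSubmodule L × (Fin 3 → Fin 3 → ℝ), ‖q‖ < εI → ∀ {a s' : ℝ}, 0 < a → 0 < s' →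
      ∫ w, Real.exp (-(a * ‖laplaceMap L q w‖ ^ 2 / s' ^ 2)) ∂(volume : Measure (NzSite L → Fin 3 → ℝ)) =
        (π * s' ^ 2 / a) ^ (flatDim L / 2 : ℝ) / Real.sqrt (gramDet L q))
    {KD εD : ℝ} (hKD : 0 ≤ KD) (hD : ∀ q : balancedSubmodule L × (Fin 3 → Fin 3 → ℝ), ‖q‖ < εD → |gramDet L q / gramDet L 0 - 1| ≤ KD * ‖q‖ ^ 2)
    {B εB : ℝ} (hB0 : 0 ≤ B) (hB : ∀ q : balancedSubmodule L × (Fin 3 → Fin 3 → ℝ), ‖q‖ < εB → ‖basedLin L q‖ ≤ B)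
    {CL εL : ℝ} (hCL : 0 ≤ CL)
    (hLip : ∀ q : balancedSubmodule L × (Fin 3 → Fin 3 → ℝ), ‖q‖ < εL → ∀ ξ : basedSubmodule L, ‖(basedLin L q - basedLin L 0) ξ‖ ≤ CL * ‖q‖ * ‖ξ‖)
    -- the profile, the amplitude, the weight
    {t b : ℝ} (ht : 0 ≤ t) (hb : 0 ≤ b) {qf : ℝ → LinkSpace L → ℝ} (hqfm : ∀ β', Measurable (qf β')) (hqf0 : ∀ β' x, 0 ≤ qf β' x)
    (hqfinv : ∀ β' (g : SU2) (x : LinkSpace L), qf β' (adL L g x) = qf β' x) (hqf : qf β = stiffGaussExp L t b) (rf : ℝ → ℝ)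
    {χ₀ : GaugeConfig 3 1 SU2 → ℝ} (hχm : Measurable χ₀) {Cχ : ℝ} (hχ0 : ∀ u, 0 ≤ χ₀ u) (hCχ : ∀ u, χ₀ u ≤ Cχ)
    (hχinv : ∀ (c : SU2) (u : GaugeConfig 3 1 SU2), χ₀ (gaugeTransform (fun _ : Site 3 1 => c) u) = χ₀ u)
    (hbo : ∀ U, boFun L χ₀ (frozenProfile L qf rf β) U ≠ 0 → recordChi L s K M β U ≠ 0)
    (ε R₁' : ℝ) {Z : ℝ} (hZ0 : 0 ≤ Z) (hZ : ∀ g : Site 3 L → SU2, ∫ c, fpWeight L ε (fun x => c * g x) ∂haarProbability SU2 = Z)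
    -- (P): the Faddeev–Popov weight on the fat tube
    {Nhi : ℝ} (hN : ∀ U ∈ fatTubeRho L (fun b' => K * powScale s b') (fun b' => M * (K * powScale s b')) β, gaugeAvg (recordChi L s K M β) U ≤ Nhi)
    -- radii and their smallness
    {ρ r R₁ ρ₁ : ℝ} (hρ0 : 0 ≤ ρ) (hρ5 : ρ ≤ 1 / 5) (hρε : 3 * ρ < εsp) (hρK : 3 * Ksp * ρ ≤ 1 / 8) (hR50 : ((2 + 24 * Ksp) * ρ) ^ 2 / 4 ≤ 1 / 50)
    (h1 : (4 + 48 * Ksp) * ρ < εT) (h2 : (4 + 48 * Ksp) * ρ < εL) (h3 : (4 + 48 * Ksp) * ρ < εB) (h4 : (4 + 48 * Ksp) * ρ ≤ 1 / 40) (h5 : 9 * Ksp * ρ < εT)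
    (h6 : (4 + 48 * Ksp) * ρ < εC) (h7 : (4 + 48 * Ksp) * ρ < εI) (h8 : (4 + 48 * Ksp) * ρ < εD) (h9 : KD * ((4 + 48 * Ksp) * ρ) ^ 2 ≤ 1 / 2)
    (hδ : Real.sqrt 2 * Fintype.card (Edge 3 L) * ρ < K * powScale s β) (hρf : Real.sqrt 2 * ρ < M * (K * powScale s β)) (hρ₁ : (2 + 24 * Ksp) * ρ < ρ₁)
    (hr0 : 0 ≤ r) (hrR : r ≤ R₁) (hR1 : R₁ ≤ 1 / 2) (hR1T : R₁ < εT) (hcore : ρ₁ + 8 * r ≤ M * (K * powScale s β))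
    (hsupp : 3 * ((L : ℝ) - 1) * (ρ₁ + M * (K * powScale s β)) ≤ R₁) (hθ : (MT + 2 * B) * R₁ * (4 * sliceConst L) ≤ 1 / 4)
    {w : Edge 3 L → Fin 3 → ℝ} (hw : ∀ e, ∑ a, w e a ^ 2 ≤ ρ ^ 2) :
    ∫ g, coreWeight L ε R₁' g * boFun L χ₀ (frozenProfile L qf rf β) (gaugeTransform g⁻¹ (latPatternChart L (fun _ => false) w)) ∂gaugeMeasure L ≤
      Z * Cχ * (Real.exp (((96 * t + b) * (B * r + MT * r ^ 2) * (2 * (Real.sqrt ((Fintype.card (Edge 3 L) : ℝ)) * ρ + (7 * ((Fintype.card (Edge 3 L) : ℝ)) * ρ + B * (9 * Ksp * ρ) + MT * (9 * Ksp * ρ) ^ 2)) + (B * r + MT * r ^ 2))) + ((96 * t + b) * ((CL * ((4 + 48 * Ksp) * ρ) * (9 * Ksp * ρ) + MT * (9 * Ksp * ρ) ^ 2) * (2 * (Real.sqrt ((Fintype.card (Edge 3 L) : ℝ)) * ρ + (7 * ((Fintype.card (Edge 3 L) : ℝ)) * ρ + B * (9 * Ksp * ρ) + MT * (9 * Ksp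 * ρ) ^ 2)) + (CL * ((4 + 48 * Ksp) * ρ) * (9 * Ksp * ρ) + MT * (9 * Ksp * ρ) ^ 2)) + 72 * ((Fintype.card (Edge 3 L) : ℝ)) * ρ ^ 3))) * Nhi + ((1 + KD * ((4 + 48 * Ksp) * ρ) ^ 2) * (4 : ℝ) ^ (flatDim L / 2 : ℝ) * Real.exp (-((1 / (4 * sliceConst L)) ^ 2 * r ^ 2 / (4 * (powScale 1 β) ^ 2))) * fpWeightBar L (powScale 1 β)) * Real.exp ((96 * t + b) * (Real.sqrt ((Fintype.card (Edge 3 L) : ℝ)) * ρ) ^ 2)) * Real.exp (-stiffGaussExp L t b (chartVec w)) := by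
  set sg := powScale 1 β with hsgdef
  set c := 1 / (4 * sliceConst L) with hcdef
  set E : ℝ := (Fintype.card (Edge 3 L) : ℝ) with hEdef
  set X := Real.sqrt E * ρ + (7 * E * ρ + B * (9 * Ksp * ρ) + MT * (9 * Ksp * ρ) ^ 2) with hXdef
  set D := B * r + MT * r ^ 2 with hDdef
  set εq := (96 * t + b) * D * (2 * X + D) with hεqdef
  set D' := CL * ((4 + 48 * Ksp) * ρ) * (9 * Ksp * ρ) + MT * (9 * Ksp * ρ) ^ 2 with hD'def
  set εtr := (96 * t + b) * (D' * (2 * X + D') + 72 * E * ρ ^ 3) with hεtrdef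
  set Tb := (1 + KD * ((4 + 48 * Ksp) * ρ) ^ 2) * (4 : ℝ) ^ (flatDim L / 2 : ℝ) * Real.exp (-(c ^ 2 * r ^ 2 / (4 * sg ^ 2))) * fpWeightBar L sg with hTbdef
  have hCχ0 : 0 ≤ Cχ := (hχ0 1).trans (hCχ 1)
  set V := latPatternChart L (fun _ => false) w with hV
  -- the representative and the transfer
  obtain ⟨c₀, ξ', p, hrep, hξ', hslice, hsc, hpn⟩ := chartPoint_slice_rep (L := L) hKsp hSP hρ0 hρ5 hρε hρK hR50 hw
  obtain ⟨hx'le, hqtr⟩ := chart_rep_transfer (L := L) ht hb hKsp hρ0 hρ5 hw hrep hξ' hpn hMT hT hCL hLip hB0 hB h1 h2 h3 h4 h5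
  obtain ⟨hVfat, hpfat, havg⟩ := chartPoint_fatTube_data (L := L) (δ := fun b' => K * powScale s b') (ρf := fun b' => M * (K * powScale s b')) hKsp hρ0 hw hδ hρf hrep hsc hρ₁
  rw [← hV] at hVfat havg
  set x' : LinkSpace L := linkEmbed L (p.1 : Edge 3 L → Fin 3 → ℝ) with hx'
  have hpT : ‖p‖ < εT := lt_of_le_of_lt hpn h1
  have hpC : ‖p‖ < εC := lt_of_le_of_lt hpn h6
  have hp40 : ‖p‖ ≤ 1 / 40 := hpn.trans h4
  have hpB : ‖basedLin L p‖ ≤ B := hB p (lt_of_le_of_lt hpn h3)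
  have hpI : ∫ w, Real.exp (-(1 / 4 * ‖laplaceMap L p w‖ ^ 2 / sg ^ 2)) ∂(volume : Measure (NzSite L → Fin 3 → ℝ)) =
      (π * sg ^ 2 / (1 / 4)) ^ (flatDim L / 2 : ℝ) / Real.sqrt (gramDet L p) := hI p (lt_of_le_of_lt hpn h7) (by norm_num) hs1
  have hpx : |gramDet L p / gramDet L 0 - 1| ≤ KD * ((4 + 48 * Ksp) * ρ) ^ 2 :=
    (hD p (lt_of_le_of_lt hpn h8)).trans (mul_le_mul_of_nonneg_left (pow_le_pow_left₀ (norm_nonneg _) hpn 2) hKD)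
  have hθp : (MT + 2 * ‖basedLin L p‖) * R₁ * (4 * sliceConst L) ≤ 1 / 4 := by
    have hCpos := sliceConst_pos L
    have hR10 : 0 ≤ R₁ := hr0.trans hrR
    calc (MT + 2 * ‖basedLin L p‖) * R₁ * (4 * sliceConst L) ≤ (MT + 2 * B) * R₁ * (4 * sliceConst L) := by gcongr
      _ ≤ 1 / 4 := hθ
  -- the orbit upper bound at `V`
  have hup := localisedAvg_orbit_upper (L := L) hL hs1 p hMT hεT hT hC hpT hpC hp40 hslice hpfat hr0 hrR hR1 hR1T hcore hsupp hθp ht hb hqfm hqf0 hqfinv hqf rf hχm hχ0 hCχ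
    hχinv hbo ε R₁' hZ0 hZ havg
  dsimp only at hup
  rw [← hx'] at hup
  -- sizes
  obtain ⟨hcw, _⟩ := norm_chartVec_relLinkVec_data (L := L) hρ0 hρ5 hw
  have hXx : ‖x'‖ ≤ X := hx'le.trans (by rw [hXdef, hEdef]; linarith [hcw])
  have hX0 : 0 ≤ X := (norm_nonneg _).trans hXx
  have h96 : 0 ≤ 96 * t + b := by positivity
  -- `ε_q(p) ≤ ε_q`
  set Dp : ℝ := ‖basedLin L p‖ * r + MT * r ^ 2 with hDp
  have hDp0 : 0 ≤ Dp := by positivity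
  have hDpD : Dp ≤ D := by
    rw [hDp, hDdef]; have := mul_le_mul_of_nonneg_right hpB hr0; linarith
  have hεqp : (96 * t + b) * Dp * (2 * ‖x'‖ + Dp) ≤ εq := by
    rw [hεqdef]
    have := mul_le_mul hDpD (by linarith : 2 * ‖x'‖ + Dp ≤ 2 * X + D) (by positivity) (hDp0.trans hDpD)
    calc (96 * t + b) * Dp * (2 * ‖x'‖ + Dp) = (96 * t + b) * (Dp * (2 * ‖x'‖ + Dp)) := by ring
      _ ≤ (96 * t + b) * (D * (2 * X + D)) := mul_le_mul_of_nonneg_left this h96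
      _ = _ := by ring
  -- `ε_tr(p) ≤ ε_tr`
  have hD'0 : 0 ≤ D' := by positivity
  have hεtrp : (96 * t + b) * (D' * (2 * ‖x'‖ + D') + 72 * Fintype.card (Edge 3 L) * ρ ^ 3) ≤ εtr := by
    rw [hεtrdef, hEdef]
    refine mul_le_mul_of_nonneg_left ?_ h96
    have := mul_le_mul_of_nonneg_left (by linarith [hXx] : 2 * ‖x'‖ + D' ≤ 2 * X + D') hD'0
    linarith
  have hq := hqtr.trans hεtrp
  -- exponential conversions
  obtain ⟨hexp1, -⟩ := exp_neg_transfer hq   -- `e^{−q(x*)} ≤ e^{ε_tr} e^{−q(chartVec w)}`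
  have hNV0 : 0 ≤ gaugeAvg (recordChi L s K M β) V := gaugeAvg_recordChi_nonneg s K M β V
  have hNV : gaugeAvg (recordChi L s K M β) V ≤ Nhi := hN V hVfat
  have hTail := laplace_tail_le_fpWeightBar (L := L) hs1 p hpI hpx h9 (c ^ 2 * r ^ 2 / (4 * sg ^ 2))
  have hEρ : 1 ≤ Real.exp ((96 * t + b) * (Real.sqrt E * ρ) ^ 2) * Real.exp (-stiffGaussExp L t b (chartVec w)) :=
    one_le_exp_mul_exp_neg_stiffGaussExp ht hb hcw
  -- assemble
  have hTb0 : 0 ≤ Tb := by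
    rw [hTbdef]; have := (fpWeightBar_pos L hs1).le; positivity
  have step1 : Cχ * Real.exp ((96 * t + b) * Dp * (2 * ‖x'‖ + Dp)) * Real.exp (-stiffGaussExp L t b x') * gaugeAvg (recordChi L s K M β) V ≤
      Cχ * (Real.exp (εq + εtr) * Nhi) * Real.exp (-stiffGaussExp L t b (chartVec w)) := by
    have e1 : Real.exp ((96 * t + b) * Dp * (2 * ‖x'‖ + Dp)) ≤ Real.exp εq := Real.exp_le_exp.2 hεqp
    have e2 : Real.exp ((96 * t + b) * Dp * (2 * ‖x'‖ + Dp)) * Real.exp (-stiffGaussExp L t b x') ≤ Real.exp εq * (Real.exp εtr * Real.exp (-stiffGaussExp L t b (chartVec w))) :=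
      mul_le_mul e1 hexp1 (Real.exp_pos _).le (Real.exp_pos _).le
    have e3 := mul_le_mul e2 hNV hNV0 (by positivity)
    calc _ = Cχ * ((Real.exp ((96 * t + b) * Dp * (2 * ‖x'‖ + Dp)) * Real.exp (-stiffGaussExp L t b x')) * gaugeAvg (recordChi L s K M β) V) := by ring
      _ ≤ Cχ * ((Real.exp εq * (Real.exp εtr * Real.exp (-stiffGaussExp L t b (chartVec w)))) * Nhi) := mul_le_mul_of_nonneg_left e3 hCχ0
      _ = _ := by rw [Real.exp_add]; ring
  have step2 : Cχ * (((2 * π ^ 2)⁻¹) ^ Fintype.card (NzSite L) * (Real.exp (-(c ^ 2 * r ^ 2 / (4 * sg ^ 2))) *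
      ∫ w, Real.exp (-(1 / 4 * ‖laplaceMap L p w‖ ^ 2 / sg ^ 2)) ∂(volume : Measure (NzSite L → Fin 3 → ℝ)))) ≤
      Cχ * (Tb * Real.exp ((96 * t + b) * (Real.sqrt E * ρ) ^ 2)) * Real.exp (-stiffGaussExp L t b (chartVec w)) := by
    have e1 := mul_le_mul_of_nonneg_left hTail hCχ0
    refine e1.trans ?_
    have e2 : Tb * 1 ≤ Tb * (Real.exp ((96 * t + b) * (Real.sqrt E * ρ) ^ 2) * Real.exp (-stiffGaussExp L t b (chartVec w))) := mul_le_mul_of_nonneg_left hEρ hTb0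
    have e3 := mul_le_mul_of_nonneg_left e2 hCχ0
    calc Cχ * ((1 + KD * ((4 + 48 * Ksp) * ρ) ^ 2) * (4 : ℝ) ^ (flatDim L / 2 : ℝ) * Real.exp (-(c ^ 2 * r ^ 2 / (4 * sg ^ 2))) * fpWeightBar L sg) = Cχ * (Tb * 1) := by
          rw [hTbdef, mul_one]
      _ ≤ _ := e3
      _ = _ := by ring
  calc _ ≤ Z * (Cχ * Real.exp ((96 * t + b) * Dp * (2 * ‖x'‖ + Dp)) * Real.exp (-stiffGaussExp L t b x') * gaugeAvg (recordChi L s K M β) V +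
        Cχ * (((2 * π ^ 2)⁻¹) ^ Fintype.card (NzSite L) * (Real.exp (-(c ^ 2 * r ^ 2 / (4 * sg ^ 2))) *
          ∫ w, Real.exp (-(1 / 4 * ‖laplaceMap L p w‖ ^ 2 / sg ^ 2)) ∂(volume : Measure (NzSite L → Fin 3 → ℝ))))) := hup
    _ ≤ Z * (Cχ * (Real.exp (εq + εtr) * Nhi) * Real.exp (-stiffGaussExp L t b (chartVec w)) +
        Cχ * (Tb * Real.exp ((96 * t + b) * (Real.sqrt E * ρ) ^ 2)) * Real.exp (-stiffGaussExp L t b (chartVec w))) := mul_le_mul_of_nonneg_left (add_le_add step1 step2) hZ0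
    _ = _ := by ring

end Summit.QuantumFields.YangMills.Theorems.FemtoTransferGap.TwoLattice.ConstTube

end
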